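import Mathlib
import Summits.NavierStokesRegularity.NavierStokesRegularity.Theorems.TaoLadderRungTwoBreakBlowupRigidityOneCriticalCeiling
import Summits.NavierStokesRegularity.NavierStokesRegularity.Theorems.TaoLadderRungTwoBreakBlowupRigidityOneCriticalEnvelope
import HarnessLib

/-!
# A robust blow-up is NEVER QUIET: at EVERY instant of every small-viscosity companion some mode is (S₁)-loud at a
  level proportional to the viscosity — the time-uniform strengthening of `criticalFloor_of_noGlobalCascade` for the
  survival step (E2) of `stub_eternalFromBlowup` (K2(1) `TaoLadderRungTwoBreak.BlowupRigidityOne`,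
  stmt-NavierStokesRegularity-20206)

MODEL lattice ODEs only (Tao 2016 §4 Lemma 4.1 (4.5), (4.8), Thm. 4.2 statement shape, the viscous lattice); nothing
here is a statement about the Navier–Stokes equations; NO item is closed (`--supports stmt-NavierStokesRegularity-20206`).
General `m`; DEF-FREE.

`criticalFloor_of_noGlobalCascade` (p823270-series, hand 3-g3) says: along the maximal `ν̂`-viscous companion of a robust
blow-up, EVERY high shell is (S₁)-loud at SOME time. This module adds the statement in the other order of quantifiers,
which is what an «absorb the front once it has thinned out» construction would have to defeat:

* `quadTerm_congr_time` — the nonlinearity is pointwise in time (bookkeeping for time translation);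
* `companion_neverQuiet_of_noGlobalCascade` — **AT EVERY TIME `t₁ ∈ [0,T)` of the maximal `ν̂`-companion
  (`0 < ν̂ ≤ κ/√2`) SOME mode `(i,k)` has `|X_{i,k}(t₁)| > (δ₀/2)(1+ε₀)^{-k/2}`**, with the explicit, viscosity-proportional
  level `δ₀ = ν̂ / (2(C_A+1)(1+ε₀)^9 · (8m²+1)(√m+1))` (`C_A = shiftConst α (0,0,1)`). Proof: were all modes inside the half
  critical envelope at `t₁`, the scale-invariant fence `criticalEnvelope_persists` (restarted at `t₁`: the time-translated,
  clamped flow) keeps the whole companion inside the envelope `δ₀(1+ε₀)^{-k/2}` for all later times; before `t₁` the high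
  shells are inside by (4.5)-regularity; so the companion carries a SMALL CRITICAL CEILING on all high shells for all
  times, and `weight45_bounded_of_smallCriticalCeiling` (3-g3) makes it (4.5)-bounded up to `T` — contradicting the
  blow-up of the maximal companion.

So a robust blow-up's companions cannot be «absorbed and re-ignite later»: there is no quiet instant at all. HONEST LABEL:
a qualitative property of the viscous companions (level ∝ ν̂, so nothing uniform as ν̂ → 0); no stub, crux or summit is
proved; rung 0.
-/

noncomputable section

-- the summit and its single sub-problem share the name (CONVENTIONS §1)
set_option linter.dupNamespace false

open Set Filter Topology

namespace Summit.NavierStokesRegularity.NavierStokesRegularity.Theorems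

namespace BlowupRigidityOne

open Literature.Analysis.FluidPDE Literature.Analysis.FluidPDE.TaoCascade

variable {m : ℕ}

/-- The cascade nonlinearity is pointwise in time: if two families agree at the two times, so do their nonlinearities.
[cite: Tao2016AveragedNS, §4 Lemma 4.1 (4.8)] -/
theorem quadTerm_congr_time {ε₀ : ℝ} (α : Fin m → Fin m → Fin m → ℤ × ℤ × ℤ → ℝ)
    {X Y : Fin m → ℤ → ℝ → ℝ} {t t' : ℝ} (h : ∀ j n, Y j n t = X j n t') (i : Fin m) (k : ℤ) :
    quadTerm ε₀ α Y i k t = quadTerm ε₀ α X i k t' := by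
  simp only [quadTerm, h]

set_option maxHeartbeats 400000 in
/-- **A ROBUST BLOW-UP IS NEVER QUIET.** Let `ε₀ > 0`, `α ∈ E₂(R)`, `NoGlobalCascade ε₀ α X₀`. There is `κ > 0` such that
for every viscosity `0 < ν̂ ≤ κ/√2` the maximal `ν̂`-viscous flow `X` on `[0,T)` from the one-shell datum (`C¹`, datum, no
shells below `0`, viscous motion, (4.5)-regular before `T`, (4.5) norm unbounded) has, AT EVERY TIME `t₁ ∈ [0,T)`, a mode
`(i,k)` with `|X_{i,k}(t₁)| > (δ₀/2)(1+ε₀)^{-k/2}`, where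
`δ₀ = ν̂ / (2(C_A+1)(1+ε₀)^9) / ((8m²+1)(√m+1))`, `C_A = shiftConst α (0,0,1)`.
[cite: Tao2016AveragedNS, §4 Thm. 4.2, the viscous equation before Thm. 4.2, Lemma 4.1 (4.5); BarbatoMorandinRomito2011, §3.1 Prop. 3.3; Teschl2012, §2.6 Cor. 2.16] -/
theorem companion_neverQuiet_of_noGlobalCascade {ε₀ R : ℝ} (hε : 0 < ε₀)
    {α : Fin m → Fin m → Fin m → ℤ × ℤ × ℤ → ℝ} {X₀ : Fin m → ℝ} (hα : InTableClass R α)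
    (hNG : NoGlobalCascade ε₀ α X₀) :
    ∃ κ : ℝ, 0 < κ ∧ ∀ visc : ℝ, 0 < visc → visc * Real.sqrt 2 ≤ κ →
      ∃ (T : ℝ) (X : Fin m → ℤ → ℝ → ℝ), 0 < T ∧
        (∀ i n, ContDiffOn ℝ 1 (X i n) (Set.Ico 0 T)) ∧
        (∀ i n, X i n 0 = if n = 0 then X₀ i else 0) ∧
        (∀ i n t, n < 0 → X i n t = 0) ∧
        (∀ i n t, 0 ≤ t → t < T → derivWithin (X i n) (Set.Ici 0) t =
          quadTerm ε₀ α X i n t - visc * (1 + ε₀) ^ ((2 : ℝ) * n) * X i n t) ∧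
        (∀ T' : ℝ, 0 < T' → T' < T → ∃ M : ℝ, ∀ t : ℝ, 0 ≤ t → t ≤ T' →
          ∀ (i : Fin m) (n : ℤ), (1 + (1 + ε₀) ^ ((10 : ℝ) * n)) * |X i n t| ≤ M) ∧
        (∀ M : ℝ, ∃ t : ℝ, 0 ≤ t ∧ t < T ∧
          ∃ (i : Fin m) (n : ℤ), M < (1 + (1 + ε₀) ^ ((10 : ℝ) * n)) * |X i n t|) ∧
        ∀ t₁ : ℝ, 0 ≤ t₁ → t₁ < T → ∃ (i : Fin m) (k : ℤ),
          (visc / (2 * (shiftConst α (0, 0, 1) + 1) * (1 + ε₀) ^ 9) /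
              ((8 * (m : ℝ) ^ 2 + 1) * (Real.sqrt m + 1))) / 2 * (1 + ε₀) ^ (-((1 / 2 : ℝ) * k))
            < |X i k t₁| := by
  obtain ⟨κ, hκ, H⟩ := maximalViscousFlow_of_noGlobalCascade hε hα hNG
  refine ⟨κ, hκ, fun visc hvisc hvk => ?_⟩
  obtain ⟨T, X, hT, h1, h2, h3, h4, h5, h6⟩ := H visc hvisc.le hvk
  refine ⟨T, X, hT, h1, h2, h3, h4, h5, h6, fun t₁ ht₁ ht₁T => ?_⟩
  have hb : (0 : ℝ) < 1 + ε₀ := by linarith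
  have hb1 : (1 : ℝ) ≤ 1 + ε₀ := by linarith
  -- standard consequences of the maximal-flow clauses (as in `criticalFloor_of_noGlobalCascade`)
  have hder : ∀ i k, ∀ τ ∈ Ico (0 : ℝ) T, HasDerivWithinAt (X i k)
      (quadTerm ε₀ α X i k τ - visc * (1 + ε₀) ^ ((2 : ℝ) * k) * X i k τ) (Ici 0) τ := by
    intro i k τ hτ
    have hd : DifferentiableWithinAt ℝ (X i k) (Ico 0 T) τ :=
      ((h1 i k).differentiableOn one_ne_zero) τ hτ
    have hd' : DifferentiableWithinAt ℝ (X i k) (Ici 0) τ :=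
      hd.mono_of_mem_nhdsWithin (by
        rw [mem_nhdsWithin]
        exact ⟨Iio T, isOpen_Iio, hτ.2, fun x hx => ⟨hx.2, hx.1⟩⟩)
    rw [← h4 i k τ hτ.1 hτ.2]
    exact hd'.hasDerivWithinAt
  have hreg : ∀ T' : ℝ, T' < T → ∃ M : ℝ, ∀ τ ∈ Icc (0 : ℝ) T', ∀ (i : Fin m) (k : ℤ),
      (1 + (1 + ε₀) ^ ((10 : ℝ) * k)) * |X i k τ| ≤ M := by
    intro T' hT'
    rcases le_or_gt T' 0 with h0 | h0
    · obtain ⟨M, hM⟩ := h5 (T / 2) (by linarith) (by linarith)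
      exact ⟨M, fun τ hτ i k => hM τ hτ.1 (by linarith [hτ.2]) i k⟩
    · obtain ⟨M, hM⟩ := h5 T' h0 hT'
      exact ⟨M, fun τ hτ i k => hM τ hτ.1 hτ.2 i k⟩
  have hamp := viscous_abs_le_datumNorm hε hvisc.le hα.2.1 hder h2 h3 hreg
  have hD : ∀ (k : ℤ) (t : ℝ), 0 ≤ t → t < T → ‖shellVec X k t‖ ≤ Real.sqrt m * Real.sqrt (∑ j, X₀ j ^ 2) :=
    fun k t ht htT => DSSOneShift.norm_shellVec_le_sqrt_mul (Real.sqrt_nonneg _) (fun i => hamp t ⟨ht, htT⟩ i k)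
  set B₀ : ℝ := visc / (2 * (shiftConst α (0, 0, 1) + 1) * (1 + ε₀) ^ 9) with hB₀_def
  have hC0 : 0 ≤ shiftConst α (0, 0, 1) := shiftConst_nonneg α _
  have hB₀ : 0 < B₀ := by positivity
  set δ₀ : ℝ := B₀ / ((8 * (m : ℝ) ^ 2 + 1) * (Real.sqrt m + 1)) with hδ₀_def
  have hden : 0 < (8 * (m : ℝ) ^ 2 + 1) * (Real.sqrt m + 1) := by positivity
  have hδ₀ : 0 < δ₀ := div_pos hB₀ hden
  -- `8 m² δ₀ < visc` and `√m δ₀ ≤ B₀`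
  have hB₀le : B₀ ≤ visc / 2 := by
    have : (2 : ℝ) ≤ 2 * (shiftConst α (0, 0, 1) + 1) * (1 + ε₀) ^ 9 := by
      have h9 : (1 : ℝ) ≤ (1 + ε₀) ^ 9 := one_le_pow₀ hb1
      nlinarith
    rw [hB₀_def]
    exact div_le_div_of_nonneg_left hvisc.le two_pos this
  have hsmall : 8 * (m : ℝ) ^ 2 * 1 * δ₀ < visc := by
    have h1' : 8 * (m : ℝ) ^ 2 * δ₀ ≤ B₀ := by
      rw [hδ₀_def]
      rw [mul_div_assoc']
      rw [div_le_iff₀ hden]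
      have hs : 0 ≤ Real.sqrt m := Real.sqrt_nonneg _
      have hP : 0 ≤ B₀ * (8 * (m : ℝ) ^ 2 + 1) * Real.sqrt m :=
        mul_nonneg (mul_nonneg hB₀.le (by positivity)) hs
      nlinarith [hB₀.le, sq_nonneg (m : ℝ), hP]
    linarith
  have hsqrtδ : Real.sqrt m * δ₀ ≤ B₀ := by
    rw [hδ₀_def, mul_div_assoc', div_le_iff₀ hden]
    have hs : 0 ≤ Real.sqrt m := Real.sqrt_nonneg _
    nlinarith [hB₀.le, sq_nonneg (m : ℝ), mul_nonneg hs (sq_nonneg (m : ℝ))]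
  -- the critical ratio `ν = (1+ε₀)^{-1/2}` in the format of `weight45_bounded_of_smallCriticalCeiling`
  set ν : ℝ := (Real.sqrt (1 + ε₀))⁻¹ with hν_def
  have hsq : 0 < Real.sqrt (1 + ε₀) := Real.sqrt_pos.2 hb
  have hν : 0 < ν := inv_pos.2 hsq
  have hνsq : ν ^ 2 = (1 + ε₀)⁻¹ := by rw [hν_def, inv_pow, Real.sq_sqrt hb.le]
  have hcrit : (1 + ε₀) * ν ^ 2 ≤ 1 := by rw [hνsq, mul_inv_cancel₀ hb.ne']
  have hνpow : ∀ n : ℕ, ν ^ (n : ℤ) = (1 + ε₀) ^ (-((1 / 2 : ℝ) * ((n : ℤ) : ℝ))) := by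
    intro n
    rw [zpow_natCast, hν_def, Real.sqrt_eq_rpow, ← Real.rpow_neg hb.le, ← Real.rpow_mul_natCast hb.le]
    congr 1
    push_cast
    ring
  -- suppose all modes are quiet at `t₁`
  by_contra hcon
  push Not at hcon
  -- table restricted to the shift set: `|α| ≤ 1` everywhere, same nonlinearity
  have hα1 := abs_restrictShiftSet_le zero_le_one (abs_le_one_of_inTableClass hα)
  -- STEP A: the critical envelope `δ₀ (1+ε₀)^{-k/2}` holds at every time `t ∈ [t₁, T)` (fence restarted at `t₁`)
  have hafter : ∀ t, t₁ ≤ t → t < T → ∀ (i : Fin m) (k : ℤ), |X i k t| ≤ δ₀ * (1 + ε₀) ^ (-((1 / 2 : ℝ) * k)) := by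
    intro t ht₁t htT i k
    set s' : ℝ := t - t₁ with hs'
    have hs'0 : 0 ≤ s' := by linarith
    -- the clamped translate `Z τ = X (t₁ + clamp τ)`
    set cl : ℝ → ℝ := fun τ => t₁ + max 0 (min τ s') with hcl
    have hcl_mem : ∀ τ, cl τ ∈ Icc t₁ t := fun τ =>
      ⟨by simp only [hcl]; linarith [le_max_left 0 (min τ s')],
       by simp only [hcl]; linarith [max_le hs'0 (min_le_right τ s')]⟩
    have hcl_id : ∀ τ ∈ Icc 0 s', cl τ = t₁ + τ := fun τ hτ => by
      simp only [hcl, min_eq_left hτ.2, max_eq_right hτ.1]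
    have hcl_cont : Continuous cl := continuous_const.add (continuous_const.max (continuous_id.min continuous_const))
    set Z : Fin m → ℤ → ℝ → ℝ := fun j n τ => X j n (cl τ) with hZ
    obtain ⟨Mt, hMt⟩ := hreg t htT
    have hZenv := criticalEnvelope_persists (α := restrictShiftSet α) (X := Z) (s := s') hε hδ₀ hα1 hsmall hs'0
      (fun j n => by
        have : Z j n 0 = X j n t₁ := by simp only [hZ, hcl, min_eq_left hs'0, max_self, add_zero]
        rw [this]; exact hcon j n)
      ⟨Mt, fun τ j n => hMt (cl τ) ⟨ht₁.trans (hcl_mem τ).1, (hcl_mem τ).2⟩ j n⟩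
      (fun j n => ((h1 j n).continuousOn.comp_continuous hcl_cont fun τ =>
        ⟨ht₁.trans (hcl_mem τ).1, lt_of_le_of_lt (hcl_mem τ).2 htT⟩))
      (fun j n τ hτ => by
        -- derivative of `τ ↦ X (t₁ + τ)` within `Icc 0 s'`, transported to `Z`
        have hmem : t₁ + τ ∈ Ico 0 T := ⟨by linarith [hτ.1], by linarith [hτ.2]⟩
        have hX := hder j n (t₁ + τ) hmem
        have hsh : HasDerivWithinAt (fun σ : ℝ => t₁ + σ) 1 (Icc 0 s') τ := by
          simpa using ((hasDerivAt_id τ).const_add t₁).hasDerivWithinAt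
        have hcomp := hX.comp τ hsh (fun σ hσ => mem_Ici.2 (by linarith [hσ.1]))
        rw [mul_one] at hcomp
        have hcongr : HasDerivWithinAt (Z j n)
            (quadTerm ε₀ α X j n (t₁ + τ) - visc * (1 + ε₀) ^ ((2 : ℝ) * n) * X j n (t₁ + τ)) (Icc 0 s') τ :=
          hcomp.congr (fun σ hσ => by simp only [hZ, hcl_id σ hσ, Function.comp])
            (by simp only [hZ, hcl_id τ hτ, Function.comp])
        have hq : quadTerm ε₀ (restrictShiftSet α) Z j n τ = quadTerm ε₀ α X j n (t₁ + τ) := by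
          rw [quadTerm_restrictShiftSet]
          exact quadTerm_congr_time α (fun j' n' => by simp only [hZ, hcl_id τ hτ]) j n
        have hZτ : Z j n τ = X j n (t₁ + τ) := by simp only [hZ, hcl_id τ hτ]
        rw [hq, hZτ]
        exact hcongr)
    have := hZenv i k s' ⟨hs'0, le_rfl⟩
    have hcls : cl s' = t := by
      rw [hcl_id s' ⟨hs'0, le_rfl⟩, hs']; ring
    have hZs : Z i k s' = X i k t := by
      simp only [hZ]; rw [hcls]
    rwa [hZs] at this
  -- STEP B: before `t₁` the high shells are inside the envelope by (4.5)-regularity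
  obtain ⟨M₁, hM₁⟩ := hreg t₁ ht₁T
  obtain ⟨J, hJ⟩ : ∃ J : ℕ, M₁ ≤ δ₀ * (1 + ε₀) ^ (J : ℝ) := by
    obtain ⟨J, hJ⟩ := pow_unbounded_of_one_lt (M₁ / δ₀) (by linarith : (1 : ℝ) < 1 + ε₀)
    exact ⟨J, by rw [Real.rpow_natCast]; exact ((div_lt_iff₀' hδ₀).1 hJ).le⟩
  have hbefore : ∀ t, 0 ≤ t → t ≤ t₁ → ∀ (i : Fin m) (n : ℕ), J ≤ n →
      |X i (n : ℤ) t| ≤ δ₀ * (1 + ε₀) ^ (-((1 / 2 : ℝ) * ((n : ℤ) : ℝ))) := by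
    intro t ht htt₁ i n hn
    have hw := hM₁ t ⟨ht, htt₁⟩ i n
    have hp10 : 0 < (1 + ε₀) ^ ((10 : ℝ) * ((n : ℤ) : ℝ)) := Real.rpow_pos_of_pos hb _
    have h1' : (1 + ε₀) ^ ((10 : ℝ) * ((n : ℤ) : ℝ)) * |X i n t| ≤ M₁ := by nlinarith [abs_nonneg (X i (n : ℤ) t)]
    have hnr : (J : ℝ) ≤ (n : ℝ) := by exact_mod_cast hn
    have hpJ : 0 < (1 + ε₀) ^ (J : ℝ) := Real.rpow_pos_of_pos hb _
    have hpn : 0 < (1 + ε₀) ^ (-((1 / 2 : ℝ) * ((n : ℤ) : ℝ))) := Real.rpow_pos_of_pos hb _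
    have hsplit2 : (1 + ε₀) ^ ((10 : ℝ) * ((n : ℤ) : ℝ))
        = (1 + ε₀) ^ ((10 : ℝ) * n - (J : ℝ) - (1 / 2 : ℝ) * n) *
          ((1 + ε₀) ^ (J : ℝ) * (1 + ε₀) ^ ((1 / 2 : ℝ) * ((n : ℤ) : ℝ))) := by
      rw [← Real.rpow_add hb, ← Real.rpow_add hb]; congr 1; push_cast; ring
    have hbig2 : 1 ≤ (1 + ε₀) ^ ((10 : ℝ) * n - (J : ℝ) - (1 / 2 : ℝ) * n) :=
      Real.one_le_rpow hb1 (by nlinarith [hnr, (Nat.cast_nonneg J : (0 : ℝ) ≤ J)])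
    have hpn2 : 0 < (1 + ε₀) ^ ((1 / 2 : ℝ) * ((n : ℤ) : ℝ)) := Real.rpow_pos_of_pos hb _
    have h6' : (1 + ε₀) ^ (J : ℝ) * (1 + ε₀) ^ ((1 / 2 : ℝ) * ((n : ℤ) : ℝ)) * |X i n t| ≤ M₁ := by
      calc (1 + ε₀) ^ (J : ℝ) * (1 + ε₀) ^ ((1 / 2 : ℝ) * ((n : ℤ) : ℝ)) * |X i n t|
          = 1 * ((1 + ε₀) ^ (J : ℝ) * (1 + ε₀) ^ ((1 / 2 : ℝ) * ((n : ℤ) : ℝ)) * |X i n t|) := by ring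
        _ ≤ (1 + ε₀) ^ ((10 : ℝ) * n - (J : ℝ) - (1 / 2 : ℝ) * n) *
              ((1 + ε₀) ^ (J : ℝ) * (1 + ε₀) ^ ((1 / 2 : ℝ) * ((n : ℤ) : ℝ)) * |X i n t|) :=
            mul_le_mul_of_nonneg_right hbig2 (by positivity)
        _ = (1 + ε₀) ^ ((10 : ℝ) * ((n : ℤ) : ℝ)) * |X i n t| := by rw [hsplit2]; ring
        _ ≤ M₁ := h1'
    have h7' : (1 + ε₀) ^ ((1 / 2 : ℝ) * ((n : ℤ) : ℝ)) * |X i n t| ≤ δ₀ := by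
      have := h6'.trans hJ
      have h8 : (1 + ε₀) ^ (J : ℝ) * ((1 + ε₀) ^ ((1 / 2 : ℝ) * ((n : ℤ) : ℝ)) * |X i n t|)
          ≤ (1 + ε₀) ^ (J : ℝ) * δ₀ := by rw [← mul_assoc, mul_comm _ δ₀]; exact this
      exact le_of_mul_le_mul_left h8 hpJ
    have hinv : (1 + ε₀) ^ (-((1 / 2 : ℝ) * ((n : ℤ) : ℝ))) * (1 + ε₀) ^ ((1 / 2 : ℝ) * ((n : ℤ) : ℝ)) = 1 := by
      rw [← Real.rpow_add hb, neg_add_cancel, Real.rpow_zero]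
    calc |X i (n : ℤ) t|
        = (1 + ε₀) ^ (-((1 / 2 : ℝ) * ((n : ℤ) : ℝ))) * ((1 + ε₀) ^ ((1 / 2 : ℝ) * ((n : ℤ) : ℝ)) * |X i n t|) := by
          rw [← mul_assoc, hinv, one_mul]
      _ ≤ (1 + ε₀) ^ (-((1 / 2 : ℝ) * ((n : ℤ) : ℝ))) * δ₀ := mul_le_mul_of_nonneg_left h7' hpn.le
      _ = δ₀ * (1 + ε₀) ^ (-((1 / 2 : ℝ) * ((n : ℤ) : ℝ))) := mul_comm _ _
  -- STEP C: a small critical ceiling on the shells `j ≥ J` for ALL times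
  have hceil : ∀ (j : ℤ) (t : ℝ), (J : ℤ) ≤ j → 0 ≤ t → t < T → ‖shellVec X j t‖ ≤ B₀ * ν ^ j := by
    intro j t hj ht htT
    obtain ⟨n, rfl⟩ := Int.eq_ofNat_of_zero_le ((Int.natCast_nonneg J).trans hj)
    have hn : J ≤ n := by exact_mod_cast hj
    have hmode : ∀ i : Fin m, |X i (n : ℤ) t| ≤ δ₀ * (1 + ε₀) ^ (-((1 / 2 : ℝ) * ((n : ℤ) : ℝ))) := by
      intro i
      rcases le_or_gt t t₁ with hle | hgt
      · exact hbefore t ht hle i n hn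
      · exact hafter t hgt.le htT i n
    have hnn : 0 ≤ δ₀ * (1 + ε₀) ^ (-((1 / 2 : ℝ) * ((n : ℤ) : ℝ))) := by positivity
    calc ‖shellVec X (n : ℤ) t‖ ≤ Real.sqrt m * (δ₀ * (1 + ε₀) ^ (-((1 / 2 : ℝ) * ((n : ℤ) : ℝ)))) :=
          DSSOneShift.norm_shellVec_le_sqrt_mul hnn hmode
      _ = (Real.sqrt m * δ₀) * (1 + ε₀) ^ (-((1 / 2 : ℝ) * ((n : ℤ) : ℝ))) := by ring
      _ ≤ B₀ * (1 + ε₀) ^ (-((1 / 2 : ℝ) * ((n : ℤ) : ℝ))) :=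
          mul_le_mul_of_nonneg_right hsqrtδ (Real.rpow_nonneg hb.le _)
      _ = B₀ * ν ^ (n : ℤ) := by rw [hνpow n]
  -- STEP D: (4.5)-boundedness up to `T`, contradicting the blow-up of the maximal companion
  obtain ⟨M, hM⟩ :=
    weight45_bounded_of_smallCriticalCeiling hε hvisc hα.2.1 h1 h2 h3 h4 hD hν hcrit hB₀.le le_rfl hceil
  obtain ⟨t, ht0, htT, i, n, hlt⟩ := h6 M
  exact absurd (hM t ht0 htT i n) (not_le.2 hlt)

end BlowupRigidityOne

end Summit.NavierStokesRegularity.NavierStokesRegularity.Theorems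

end
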